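import Summits.ResolutionOfSingularities.ResolutionOfSingularities.Theorems.WeightedInvariantIota3RatioOneDominanceFlags
import Summits.ResolutionOfSingularities.ResolutionOfSingularities.Theorems.WeightedInvariantIota3DominanceWordsDefs
import HarnessLib

/-!
# The dominance word `TwoFlagDominanceAtLevelLE3Body p` REDUCED TO ITS RESIDUE `q < r₂ < r₁` (second member only)
# (door `HypersurfaceCentreConstruction`, stmt-ResolutionOfSingularities-19897; P3 rung for the named pair `(ι₃ᵗ, J₃ᵗ)`:
# h8's point bodies (P₀₀)/(P₀₁) ⟸ (σ-pres)₃ ⟸ THIS ONE WORD, `keyRungGrHomLE_three_of_dominance`)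

Topic: `Summits/ResolutionOfSingularities/ResolutionOfSingularities/Theorems`. Helper for the door item `HypersurfaceCentreConstruction`
(stmt-ResolutionOfSingularities-19897, route `WeightedInvariant`), line `local-engine`, def-free.  Assembly of the three regimes of the
dominance word `Iota3.TwoFlagDominanceAtLevelAt f` (…Iota3DominanceWordsDefs, SPEC (Δ12) rev 4) at a point `0 ≠ f ∈ 𝔪` of a regular local
ring of dimension `3`:
* `r₁ = r₂` — `Iota3.dominanceAtLevel_of_r₁_eq_r₂` (…Iota3RatioOneDominanceFlags, this hand: the ratio-one regime, brk-1 memo §6b);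
* `r₂ = q < r₁` — PART 1 `Iota3.mem_flagContactFiltration_of_reaches_of_r₂_eq_q` (…JSigmaDominanceGeneric, p564416; reaching alone);
* `q < r₂ < r₁` — THE RESIDUE: by (E1) `Iota3.mem_weight₁_of_mem_weight₂` (…JSigmaDominanceSecondMember) only the SECOND membership
  `g₂' ∈ F_{(g₁,g₂)}(r₂)` is needed.
Hence `Iota3.twoFlagDominanceAtLevelAt_of_residue` and, position by position, `twoFlagDominanceAtLevelLE3Body_of_residue`: the word of
record follows from the second-member dominance at the triples `q < r₂ < r₁` (the purely inseparable first face of the memo, §5–§7 —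
OPEN; nothing here claims it).  RE-ENTRY OBJECT #1 of CHAIN w43 is now exactly that residue, kernel-certified.

[OURS · L1 W4.3 · (o70-b)/(Δ12)]  Replaces the role of NO printed item; NOT a statement of the manuscript [claim: Hironaka2017,
status: under-review]. AI work, weaker than expert review.  Pure commutative algebra; no named facts; no definition.

## References

* V. Cossart, U. Jannsen, S. Saito, LNM 2270 (2020), Def. 8.2, Lemma 8.3. [CossartJannsenSaito2020]
* res-D-brk-1, `D/res-D-brk-1/O70B-JCAN-PLAN.md` §5–§7 (OURS, AI analysis, 2026-08-27).
-/

noncomputable section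

set_option linter.dupNamespace false -- mandated namespace `Summit.<Summit>.<Problem>` of this single-conjunct summit

open IsLocalRing Literature.AlgebraicGeometry.Resolution
open Summit.ResolutionOfSingularities.ResolutionOfSingularities.Theorems

namespace Summit.ResolutionOfSingularities.ResolutionOfSingularities.Cruxes.HypersurfaceCentreConstruction.LocalEngine

namespace Iota3

/-! ## §8 The dominance word REDUCED TO ITS RESIDUE `q < r₂ < r₁` (second member only) -/

section Residue

variable {S : Type} [CommRing S] [IsRegularLocalRing S]

/-- **`TwoFlagDominanceAtLevelAt f` FROM ITS RESIDUE.**  At `0 ≠ f ∈ 𝔪` of a regular local ring of dimension `3`, the dominance word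
holds as soon as its instances with `q < r₂ < r₁` give the SECOND membership `g₂' ∈ F_{(g₁,g₂)}(r₂)`: the regime `r₁ = r₂` is
`dominanceAtLevel_of_r₁_eq_r₂` (PART 3), the regime `r₂ = q` is PART 1 `mem_flagContactFiltration_of_reaches_of_r₂_eq_q` (p564416, from
reaching alone), and at `q ≤ r₂ < r₁` the first membership follows from the second by (E1) `mem_weight₁_of_mem_weight₂`
(…JSigmaDominanceSecondMember).  So RE-ENTRY OBJECT #1 of CHAIN w43 is exactly this residue (brk-1 memo §5–§7: the purely inseparable
first face). [OURS · L1 W4.3 · (o70-b)/(Δ12)] -/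
theorem twoFlagDominanceAtLevelAt_of_residue (hdim : ringKrullDim S = (3 : ℕ)) {f : S} (hf0 : f ≠ 0) (hfm : f ∈ maximalIdeal S)
    (hres : ∀ (a b : ℕ), 0 < b →
      (∀ q' r₁' r₂' : ℕ, AdmissibleTriple q' r₁' r₂' → FlagReaches f (adicOrder f).toNat q' r₁' r₂' → r₁' * b ≤ a * r₂') →
      ∀ (g₁ g₂ g₁' g₂' : S) (q r₁ r₂ : ℕ), AdmissibleTriple q r₁ r₂ → r₁ * b = a * r₂ → q < r₂ → r₂ < r₁ →
        IsTwoFlag g₁ g₂ → IsTwoFlag g₁' g₂' →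
        f ∈ flagContactFiltration g₁ g₂ q r₁ r₂ (r₁ * (adicOrder f).toNat) →
        f ∈ flagContactFiltration g₁' g₂' q r₁ r₂ (r₁ * (adicOrder f).toNat) →
        g₂' ∈ flagContactFiltration g₁ g₂ q r₁ r₂ r₂) :
    TwoFlagDominanceAtLevelAt f := by
  intro a b hb hbound g₁ g₂ g₁' g₂' q r₁ r₂ hadm hab hΦ hΦ' hF hF'
  obtain ⟨hν, -, hford⟩ := EssSmoothLevels.adicOrder_toNat_spec hf0 hfm
  rcases (hadm.2.2 : r₂ ≤ r₁).eq_or_lt with hrr | hlt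
  · exact dominanceAtLevel_of_r₁_eq_r₂ hdim hf0 hfm hb hbound hadm hab hrr.symm hΦ hΦ' hF hF'
  · rcases (hadm.2.1 : q ≤ r₂).eq_or_lt with hq2 | hqlt
    · subst hq2
      exact mem_flagContactFiltration_of_reaches_of_r₂_eq_q hadm.1 hadm.2.2 hν hford hΦ hΦ'.1 hΦ'.2.1 hF hF'
    · have h₂ := hres a b hb hbound g₁ g₂ g₁' g₂' q r₁ r₂ hadm hab hqlt hlt hΦ hΦ' hF hF'
      obtain ⟨x, hx, -⟩ := exists_span_triple_of_isTwoFlag S hdim g₁ g₂ hΦ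
      have hdim' : ringKrullDim S = 3 := by rw [hdim]; rfl
      exact ⟨mem_weight₁_of_mem_weight₂ hdim' hx hadm.1 hadm.2.1 hlt hν hford hF hΦ'.1 hΦ'.2.1 hF' h₂, h₂⟩

end Residue

end Iota3

/-- **`TwoFlagDominanceAtLevelLE3Body p` FROM ITS RESIDUE** (position by position): the LE3 dominance word of SPEC (Δ12) rev 4 — the ONE
word through which (σ-pres)₃, hence the point bodies (P₀₀)/(P₀₁) of h8 and the (pres) sub-block of the P3 rung for the named pair
`(ι₃ᵗ, J₃ᵗ)`, are routed (`sigmaPresentationLE3_of_dominance`, `keyRungGrHomLE_three_of_dominance`) — follows from the SECOND-MEMBER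
dominance at the triples with `q < r₂ < r₁` at the same positions. [OURS · L1 W4.3 · (o70-b)/(Δ12)] -/
theorem twoFlagDominanceAtLevelLE3Body_of_residue (p : ℕ)
    (hres : ∀ (k₀ : Type) [Field k₀] [CharP k₀ p] [PerfectField k₀]
      (S : Type) [CommRing S] [Algebra k₀ S] [Algebra.EssFiniteType k₀ S] [IsRegularLocalRing S] (f : S),
      ringKrullDim S = (3 : ℕ) → f ≠ 0 → f ∈ (maximalIdeal S) ^ 2 →
      ContactCylinder.topStratumPrime Iota3.iotaOrdEpsTau S f = maximalIdeal S → Iota3.iotaEps S f ≠ 1 →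
      ∀ (a b : ℕ), 0 < b →
      (∀ q' r₁' r₂' : ℕ, Iota3.AdmissibleTriple q' r₁' r₂' → Iota3.FlagReaches f (adicOrder f).toNat q' r₁' r₂' →
        r₁' * b ≤ a * r₂') →
      ∀ (g₁ g₂ g₁' g₂' : S) (q r₁ r₂ : ℕ), Iota3.AdmissibleTriple q r₁ r₂ → r₁ * b = a * r₂ → q < r₂ → r₂ < r₁ →
        Iota3.IsTwoFlag g₁ g₂ → Iota3.IsTwoFlag g₁' g₂' →
        f ∈ Iota3.flagContactFiltration g₁ g₂ q r₁ r₂ (r₁ * (adicOrder f).toNat) →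
        f ∈ Iota3.flagContactFiltration g₁' g₂' q r₁ r₂ (r₁ * (adicOrder f).toNat) →
        g₂' ∈ Iota3.flagContactFiltration g₁ g₂ q r₁ r₂ r₂) :
    TwoFlagDominanceAtLevelLE3Body p := by
  intro k₀ _ _ _ S _ _ _ _ f hdim hf0 hf2 htop hε
  exact Iota3.twoFlagDominanceAtLevelAt_of_residue hdim hf0 (Ideal.pow_le_self two_ne_zero hf2)
    (hres k₀ S f hdim hf0 hf2 htop hε)


end Summit.ResolutionOfSingularities.ResolutionOfSingularities.Cruxes.HypersurfaceCentreConstruction.LocalEngine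

end
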